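import Summits.NavierStokesRegularity.NavierStokesRegularity.Theorems.PerpetualPumpAveragedTypeIBlowupLinearComparison
import Mathlib.Analysis.Complex.ExponentialBounds
import Mathlib.Topology.Order.IntermediateValue

/-!
# Crux `PerpetualPump.AveragedTypeIBlowup` (stmt-NavierStokesRegularity-1835), line `Sketch`:
# tools for the stub `trailPair` — supersolution bounds for a damped carrier/bond pair

This file collects the Mathlib-only real-analysis tools used by the registered stub `stub_trailPair`
(the quiet trail of a spent carrier/bond pair of the seeded Toda circuit) of the line skeleton
`Cruxes/AveragedTypeIBlowup/Lines/Sketch.lean`; the stub itself is proved in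
`PerpetualPumpAveragedTypeIBlowupTrailPair.lean`.

* `trailPair_integral_kernel_le`, `trailPair_majorant_le` — the Duhamel kernel has mass
  `∫₀^τ e^{-θ(τ-u)} du ≤ 1/θ`, so a memory majorant `m ≤ M e^{-θτ} + ∫₀^τ e^{-θ(τ-u)} |g|` with
  `|g| ≤ C` obeys `m ≤ M e^{-θτ} + C/θ`.
* `trailPair_mul_exp_neg_le` — `u e^{-c u} ≤ 3/(8c)` (from `x ≤ e^{x-1}` and `e ≥ 8/3`).
* `trailPair_realInduction` — continuous induction on `[0, T]` for a continuous function: if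
  `f 0 ≤ 0` and `f ≤ 0` on `[0, τ]` forces `f τ < 0`, then `f ≤ 0` on `[0, T]` (the bootstrap).
* `trailPair_nonpos_of_deriv_le` — `d' ≤ K d` inside, `d(0) ≤ 0` ⇒ `d ≤ 0` (from the landed
  `linearComparison_upper` with zero forcing).
* `trailPair_carrier` — `|x' + x| ≤ A + B e^{-θt}` (`θ ≤ 1`) ⇒ `|x(τ) - x(0)e^{-τ}| ≤ A + Bτe^{-θτ}`,
  by comparing `±(x - x(0)e^{-t})` with the explicit supersolution `A + B t e^{-θt}`.
* `trailPair_bond` — `|x' - r x| ≤ a + B e^{-θt}` with a rate `r ≤ -ρ < 0`, `ρ ≤ θ` ⇒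
  `|x(τ)| ≤ a/ρ + (c₀ + Bτ) e^{-ρτ}` (`|x(0)| ≤ c₀`), by comparing `±x` with the supersolution
  `a/ρ + (c₀ + B t) e^{-ρt}` of `y' = -ρ y + a + B e^{-θt}`.
* `stub_trailPairTools` — the registered tools stub (carrier bound ∧ bond bound ∧ induction).

No integrals are evaluated beyond `∫ e^{-θ(τ-u)} du`: the supersolutions are differentiated instead.

## References

Folklore ODE comparison arguments, used as in T. Tao, *Finite time blowup for an averaged
three-dimensional Navier–Stokes equation*, J. Amer. Math. Soc. 29 (2016), §5–6.
-/

noncomputable section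

-- the summit namespace `…NavierStokesRegularity.NavierStokesRegularity…` is the tree convention
set_option linter.dupNamespace false

open MeasureTheory Set Filter Topology

namespace Summit.NavierStokesRegularity.NavierStokesRegularity.Theorems.PerpetualPumpAveragedTypeIBlowup

/-- **Mass of the Duhamel kernel.** For `θ > 0` and `C ≥ 0`,
`∫₀^τ e^{-θ (τ - u)} C du = C (1 - e^{-θ τ}) / θ ≤ C / θ` (fundamental theorem of calculus for the
antiderivative `u ↦ e^{-θ(τ - u)} C / θ`). [folklore] -/
theorem trailPair_integral_kernel_le {θ C : ℝ} (hθ : 0 < θ) (hC : 0 ≤ C) (τ : ℝ) :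
    ∫ u in (0 : ℝ)..τ, Real.exp (-(θ * (τ - u))) * C ≤ C / θ := by
  have hderiv : ∀ u : ℝ, HasDerivAt (fun u => Real.exp (-(θ * (τ - u))) * (C / θ))
      (Real.exp (-(θ * (τ - u))) * -(θ * -1) * (C / θ)) u := fun u =>
    (((hasDerivAt_id' u).const_sub τ).const_mul θ).neg.exp.mul_const (C / θ)
  have hcont : Continuous fun u : ℝ => Real.exp (-(θ * (τ - u))) * -(θ * -1) * (C / θ) := by
    fun_prop
  have key : ∫ u in (0 : ℝ)..τ, Real.exp (-(θ * (τ - u))) * -(θ * -1) * (C / θ) =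
      Real.exp (-(θ * (τ - τ))) * (C / θ) - Real.exp (-(θ * (τ - 0))) * (C / θ) :=
    intervalIntegral.integral_eq_sub_of_hasDerivAt (fun u _ => hderiv u)
      (hcont.intervalIntegrable 0 τ)
  have hfun : (fun u => Real.exp (-(θ * (τ - u))) * C) =
      fun u => Real.exp (-(θ * (τ - u))) * -(θ * -1) * (C / θ) := by
    funext u
    field_simp
  rw [hfun, key, sub_self, mul_zero, neg_zero, Real.exp_zero, one_mul, sub_zero]
  have h1 : 0 ≤ Real.exp (-(θ * τ)) * (C / θ) := by positivity
  linarith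

/-- **Duhamel majorant under a pointwise bound.** If `g` is continuous with `|g| ≤ C` on `[0, τ]`
and `m ≤ M e^{-θ τ} + ∫₀^τ e^{-θ (τ - u)} |g(u)| du` with `M ≤ M'`, then `m ≤ M' e^{-θ τ} + C / θ`.
[folklore] -/
theorem trailPair_majorant_le {g : ℝ → ℝ} {θ C M M' τ m : ℝ} (hθ : 0 < θ) (hC : 0 ≤ C)
    (hτ : 0 ≤ τ) (hg : ContinuousOn g (Icc 0 τ)) (hgC : ∀ u ∈ Icc 0 τ, |g u| ≤ C) (hM : M ≤ M')
    (hm : m ≤ M * Real.exp (-(θ * τ)) + ∫ u in (0 : ℝ)..τ, Real.exp (-(θ * (τ - u))) * |g u|) :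
    m ≤ M' * Real.exp (-(θ * τ)) + C / θ := by
  have hEc : Continuous fun u : ℝ => Real.exp (-(θ * (τ - u))) := by fun_prop
  have hi1 : IntervalIntegrable (fun u => Real.exp (-(θ * (τ - u))) * |g u|) volume 0 τ :=
    (hEc.continuousOn.mul (continuous_abs.comp_continuousOn hg)).intervalIntegrable_of_Icc hτ
  have hi2 : IntervalIntegrable (fun u => Real.exp (-(θ * (τ - u))) * C) volume 0 τ :=
    (hEc.mul continuous_const).intervalIntegrable 0 τ
  have hmono : ∫ u in (0 : ℝ)..τ, Real.exp (-(θ * (τ - u))) * |g u| ≤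
      ∫ u in (0 : ℝ)..τ, Real.exp (-(θ * (τ - u))) * C :=
    intervalIntegral.integral_mono_on hτ hi1 hi2 fun u hu =>
      mul_le_mul_of_nonneg_left (hgC u hu) (Real.exp_pos _).le
  have hint := trailPair_integral_kernel_le hθ hC τ
  have hE := Real.exp_pos (-(θ * τ))
  have h1 := mul_le_mul_of_nonneg_right hM hE.le
  linarith

/-- **The elementary bound `u e^{-c u} ≤ 3 / (8 c)`** for `c > 0` and every real `u`
(from `x ≤ e^{x - 1}` with `x = c u`, and `e^{-1} ≤ 3/8`). [folklore] -/
theorem trailPair_mul_exp_neg_le {c : ℝ} (hc : 0 < c) (u : ℝ) :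
    u * Real.exp (-(c * u)) ≤ 3 / (8 * c) := by
  have h1 := Real.add_one_le_exp (c * u - 1)
  have hE : Real.exp (c * u - 1) * Real.exp (-(c * u)) = Real.exp (-1) := by
    rw [← Real.exp_add]
    ring_nf
  have he1 : Real.exp (-1) ≤ 3 / 8 := by
    have h := Real.exp_one_gt_d9
    have hprod : Real.exp (-1) * Real.exp 1 = 1 := by
      rw [← Real.exp_add]
      norm_num
    nlinarith [Real.exp_pos (-1)]
  have h3 : c * u * Real.exp (-(c * u)) ≤ Real.exp (-1) := by
    calc c * u * Real.exp (-(c * u)) ≤ Real.exp (c * u - 1) * Real.exp (-(c * u)) :=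
          mul_le_mul_of_nonneg_right (by linarith) (Real.exp_pos _).le
      _ = Real.exp (-1) := hE
  rw [le_div_iff₀ (by positivity)]
  have h4 : u * Real.exp (-(c * u)) * (8 * c) = 8 * (c * u * Real.exp (-(c * u))) := by ring
  rw [h4]
  linarith

/-- **Continuous induction on `[0, T]` (the bootstrap principle).** If `f` is continuous on
`[0, T]`, `f 0 ≤ 0`, and `f τ < 0` whenever `τ ∈ [0, T]` and `f ≤ 0` on `[0, τ]`, then `f ≤ 0` on
`[0, T]`: the set of `τ` up to which `f ≤ 0` holds is closed, contains `0`, and is open to the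
right (`IsClosed.Icc_subset_of_forall_mem_nhdsWithin`). [folklore] -/
theorem trailPair_realInduction {f : ℝ → ℝ} {T : ℝ} (hf : ContinuousOn f (Icc 0 T))
    (h0 : f 0 ≤ 0) (hstep : ∀ τ ∈ Icc 0 T, (∀ u ∈ Icc 0 τ, f u ≤ 0) → f τ < 0) :
    ∀ τ ∈ Icc 0 T, f τ ≤ 0 := by
  have key : Icc 0 T ⊆ {τ | ∀ u ∈ Icc 0 T, u ≤ τ → f u ≤ 0} := by
    apply IsClosed.Icc_subset_of_forall_mem_nhdsWithin
    · -- closedness: `s ∩ [0,T] = {τ ∈ [0,T] | f τ ≤ 0} ∩ ⋂_{bad u} (-∞, u]`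
      have hrepr : {τ | ∀ u ∈ Icc 0 T, u ≤ τ → f u ≤ 0} ∩ Icc 0 T =
          (Icc 0 T ∩ f ⁻¹' Iic 0) ∩ ⋂ u ∈ {u | u ∈ Icc 0 T ∧ ¬ f u ≤ 0}, Iic u := by
        ext τ
        simp only [mem_inter_iff, mem_setOf_eq, mem_preimage, mem_Iic, mem_iInter]
        constructor
        · rintro ⟨h, hτ⟩
          refine ⟨⟨hτ, h τ hτ le_rfl⟩, fun u hu => ?_⟩
          by_contra hlt
          exact hu.2 (h u hu.1 (not_le.1 hlt).le)
        · rintro ⟨⟨hτ, hfτ⟩, h⟩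
          refine ⟨fun u hu huτ => ?_, hτ⟩
          by_contra hfu
          have hτu : τ ≤ u := h u ⟨hu, hfu⟩
          have : u = τ := le_antisymm huτ hτu
          rw [this] at hfu
          exact hfu hfτ
      rw [hrepr]
      exact (hf.preimage_isClosed_of_isClosed isClosed_Icc isClosed_Iic).inter
        (isClosed_biInter fun u _ => isClosed_Iic)
    · intro u hu hu0
      have : u = 0 := le_antisymm hu0 hu.1
      rw [this]
      exact h0
    · rintro x ⟨hx, hxI⟩
      have hxT : x ∈ Icc 0 T := ⟨hxI.1, hxI.2.le⟩
      have hfx : f x < 0 :=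
        hstep x hxT fun u hu => hx u ⟨hu.1, hu.2.trans hxT.2⟩ hu.2
      have hev : f ⁻¹' Iio 0 ∈ 𝓝[Icc 0 T] x := hf x hxT (Iio_mem_nhds hfx)
      obtain ⟨δ, hδ, hball⟩ := Metric.mem_nhdsWithin_iff.1 hev
      have hsub : Ioo x (x + δ) ⊆ {τ | ∀ u ∈ Icc 0 T, u ≤ τ → f u ≤ 0} := by
        intro τ hτ u hu huτ
        by_cases hux : u ≤ x
        · exact hx u hu hux
        · have hxu : x < u := not_le.1 hux
          have hdist : u ∈ Metric.ball x δ := by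
            rw [Metric.mem_ball, Real.dist_eq, abs_lt]
            constructor <;> linarith [hτ.2]
          exact le_of_lt (hball ⟨hdist, hu⟩)
      exact Filter.mem_of_superset (Ioo_mem_nhdsGT (by linarith)) hsub
  intro τ hτ
  exact key hτ τ hτ le_rfl

/-- **Sign form of the linear comparison.** If `d, K` are continuous on `[0, T]`, `d 0 ≤ 0` and
`d' ≤ K d` at interior points, then `d ≤ 0` on `[0, T]` (`linearComparison_upper` with zero
forcing). [folklore] -/
theorem trailPair_nonpos_of_deriv_le {d K : ℝ → ℝ} {T : ℝ} (hT : 0 ≤ T)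
    (hK : ContinuousOn K (Icc 0 T)) (hd : ContinuousOn d (Icc 0 T)) (hd0 : d 0 ≤ 0)
    (hdd : ∀ t ∈ Ioo 0 T, ∃ d' : ℝ, HasDerivAt d d' t ∧ d' ≤ K t * d t) :
    ∀ τ ∈ Icc 0 T, d τ ≤ 0 := by
  intro τ hτ
  have hdd' : ∀ t ∈ Ioo 0 T, ∃ d' : ℝ, HasDerivAt d d' t ∧
      d' ≤ K t * d t + (fun _ : ℝ => (0 : ℝ)) t := fun t ht => by
    obtain ⟨d', h1, h2⟩ := hdd t ht
    exact ⟨d', h1, by simpa using h2⟩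
  have h := linearComparison_upper hT hK continuousOn_const hd hdd' hτ
  simp only [mul_zero, intervalIntegral.integral_zero, add_zero] at h
  have h2 : Real.exp (∫ s in (0 : ℝ)..τ, K s) * d 0 ≤ Real.exp (∫ s in (0 : ℝ)..τ, K s) * 0 :=
    mul_le_mul_of_nonneg_left hd0 (Real.exp_pos _).le
  rw [mul_zero] at h2
  exact h.trans h2

/-- **Carrier relaxation, one-sided.** If `x` is continuous on `[0, T]` and `x' + x ≤ A + B e^{-θ t}`
at interior points (`A, B ≥ 0`, `θ ≤ 1`), then `x(τ) - x(0) e^{-τ} ≤ A + B τ e^{-θ τ}` on `[0, T]`: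
`d = x - x(0)e^{-t} - (A + B t e^{-θ t})` satisfies `d' ≤ -d` and `d(0) = -A ≤ 0`. [folklore] -/
theorem trailPair_carrier_upper {x : ℝ → ℝ} {A B θ T : ℝ} (hT : 0 ≤ T) (hA : 0 ≤ A) (hB : 0 ≤ B)
    (hθ1 : θ ≤ 1) (hx : ContinuousOn x (Icc 0 T))
    (hd : ∀ t ∈ Ioo 0 T, ∃ x' : ℝ, HasDerivAt x x' t ∧ x' + x t ≤ A + B * Real.exp (-(θ * t))) :
    ∀ τ ∈ Icc 0 T, x τ - x 0 * Real.exp (-τ) ≤ A + B * τ * Real.exp (-(θ * τ)) := by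
  have hy : ∀ u : ℝ, HasDerivAt (fun u => A + B * u * Real.exp (-(θ * u)))
      (B * 1 * Real.exp (-(θ * u)) + B * u * (Real.exp (-(θ * u)) * -(θ * 1))) u := fun u =>
    (((hasDerivAt_id' u).const_mul B).mul ((hasDerivAt_id' u).const_mul θ).neg.exp).const_add A
  have hex : ∀ u : ℝ, HasDerivAt (fun u => x 0 * Real.exp (-u)) (x 0 * (Real.exp (-u) * -1)) u :=
    fun u => (hasDerivAt_id' u).neg.exp.const_mul (x 0)
  have hyc : Continuous fun u => A + B * u * Real.exp (-(θ * u)) := by fun_prop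
  have hexc : Continuous fun u => x 0 * Real.exp (-u) := by fun_prop
  have hdc : ContinuousOn (fun u => x u - x 0 * Real.exp (-u) - (A + B * u * Real.exp (-(θ * u))))
      (Icc 0 T) := (hx.sub hexc.continuousOn).sub hyc.continuousOn
  have hdd : ∀ t ∈ Ioo 0 T, ∃ d' : ℝ,
      HasDerivAt (fun u => x u - x 0 * Real.exp (-u) - (A + B * u * Real.exp (-(θ * u)))) d' t ∧
        d' ≤ -1 * (x t - x 0 * Real.exp (-t) - (A + B * t * Real.exp (-(θ * t)))) := by
    intro t ht
    obtain ⟨x', hx', hb⟩ := hd t ht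
    refine ⟨_, (hx'.sub (hex t)).sub (hy t), ?_⟩
    have hE := Real.exp_pos (-(θ * t))
    have hP : 0 ≤ B * t * Real.exp (-(θ * t)) * (1 - θ) :=
      mul_nonneg (mul_nonneg (mul_nonneg hB ht.1.le) hE.le) (by linarith)
    linarith
  have h0 : (fun u => x u - x 0 * Real.exp (-u) - (A + B * u * Real.exp (-(θ * u)))) 0 ≤ 0 := by
    simp only [neg_zero, Real.exp_zero, mul_one, mul_zero, add_zero, sub_self, zero_sub,
      neg_nonpos]
    exact hA
  intro τ hτ
  have h := trailPair_nonpos_of_deriv_le (K := fun _ => -1) hT continuousOn_const hdc h0 hdd τ hτ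
  linarith

/-- **Carrier relaxation.** If `x` is continuous on `[0, T]` and `|x' + x| ≤ A + B e^{-θ t}` at
interior points (`A, B ≥ 0`, `θ ≤ 1`), then `|x(τ) - x(0) e^{-τ}| ≤ A + B τ e^{-θ τ}` on `[0, T]`
(the one-sided bound for `x` and for `-x`). [folklore] -/
theorem trailPair_carrier {x : ℝ → ℝ} {A B θ T : ℝ} (hT : 0 ≤ T) (hA : 0 ≤ A) (hB : 0 ≤ B)
    (hθ1 : θ ≤ 1) (hx : ContinuousOn x (Icc 0 T))
    (hd : ∀ t ∈ Ioo 0 T, ∃ x' : ℝ, HasDerivAt x x' t ∧ |x' + x t| ≤ A + B * Real.exp (-(θ * t))) :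
    ∀ τ ∈ Icc 0 T, |x τ - x 0 * Real.exp (-τ)| ≤ A + B * τ * Real.exp (-(θ * τ)) := by
  intro τ hτ
  have hup := trailPair_carrier_upper hT hA hB hθ1 hx (fun t ht => by
    obtain ⟨x', hx', hb⟩ := hd t ht
    exact ⟨x', hx', (abs_le.1 hb).2⟩) τ hτ
  have hlo := trailPair_carrier_upper (x := fun t => -x t) hT hA hB hθ1 hx.neg (fun t ht => by
    obtain ⟨x', hx', hb⟩ := hd t ht
    exact ⟨-x', hx'.neg, by linarith [(abs_le.1 hb).1]⟩) τ hτ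
  rw [abs_le]
  constructor <;> linarith

/-- **Bond damping, one-sided.** If `x, r` are continuous on `[0, T]`, `r ≤ -ρ < 0` inside,
`x' - r x ≤ a + B e^{-θ t}` inside (`a, B ≥ 0`, `ρ ≤ θ`) and `x(0) ≤ c₀` with `c₀ ≥ 0`, then
`x(τ) ≤ a / ρ + (c₀ + B τ) e^{-ρ τ}` on `[0, T]`: the right-hand side `y` is a nonnegative
supersolution of `y' = -ρ y + a + B e^{-θ t}`, so `d = x - y` satisfies `d' ≤ r d`, `d(0) ≤ 0`.
[folklore] -/
theorem trailPair_bond_upper {x r : ℝ → ℝ} {a B c₀ ρ θ T : ℝ} (hT : 0 ≤ T) (ha : 0 ≤ a)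
    (hB : 0 ≤ B) (hc₀ : 0 ≤ c₀) (hρ : 0 < ρ) (hρθ : ρ ≤ θ) (hx : ContinuousOn x (Icc 0 T))
    (hr : ContinuousOn r (Icc 0 T)) (hrρ : ∀ t ∈ Ioo 0 T, r t ≤ -ρ) (hx0 : x 0 ≤ c₀)
    (hd : ∀ t ∈ Ioo 0 T, ∃ x' : ℝ, HasDerivAt x x' t ∧
      x' - r t * x t ≤ a + B * Real.exp (-(θ * t))) :
    ∀ τ ∈ Icc 0 T, x τ ≤ a / ρ + (c₀ + B * τ) * Real.exp (-(ρ * τ)) := by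
  have haρ : ρ * (a / ρ) = a := by field_simp
  have hy : ∀ u : ℝ, HasDerivAt (fun u => a / ρ + (c₀ + B * u) * Real.exp (-(ρ * u)))
      (B * 1 * Real.exp (-(ρ * u)) + (c₀ + B * u) * (Real.exp (-(ρ * u)) * -(ρ * 1))) u := fun u =>
    ((((hasDerivAt_id' u).const_mul B).const_add c₀).mul
      ((hasDerivAt_id' u).const_mul ρ).neg.exp).const_add (a / ρ)
  have hyc : Continuous fun u => a / ρ + (c₀ + B * u) * Real.exp (-(ρ * u)) := by fun_prop
  have hdc : ContinuousOn (fun u => x u - (a / ρ + (c₀ + B * u) * Real.exp (-(ρ * u))))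
      (Icc 0 T) := hx.sub hyc.continuousOn
  have hdd : ∀ t ∈ Ioo 0 T, ∃ d' : ℝ,
      HasDerivAt (fun u => x u - (a / ρ + (c₀ + B * u) * Real.exp (-(ρ * u)))) d' t ∧
        d' ≤ r t * (x t - (a / ρ + (c₀ + B * t) * Real.exp (-(ρ * t)))) := by
    intro t ht
    obtain ⟨x', hx', hb⟩ := hd t ht
    refine ⟨_, hx'.sub (hy t), ?_⟩
    -- the supersolution inequality at `t`
    have hE1 : B * Real.exp (-(θ * t)) ≤ B * Real.exp (-(ρ * t)) :=
      mul_le_mul_of_nonneg_left (Real.exp_le_exp.2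
        (by have := mul_le_mul_of_nonneg_right hρθ ht.1.le; linarith)) hB
    have hY : 0 ≤ a / ρ + (c₀ + B * t) * Real.exp (-(ρ * t)) := by
      have : 0 ≤ (c₀ + B * t) * Real.exp (-(ρ * t)) :=
        mul_nonneg (by have := mul_nonneg hB ht.1.le; linarith) (Real.exp_pos _).le
      have : 0 ≤ a / ρ := div_nonneg ha hρ.le
      linarith
    have h2 : ρ * (a / ρ + (c₀ + B * t) * Real.exp (-(ρ * t))) ≤
        -r t * (a / ρ + (c₀ + B * t) * Real.exp (-(ρ * t))) :=
      mul_le_mul_of_nonneg_right (by linarith [hrρ t ht]) hY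
    linarith
  have h0 : (fun u => x u - (a / ρ + (c₀ + B * u) * Real.exp (-(ρ * u)))) 0 ≤ 0 := by
    simp only [mul_zero, add_zero, neg_zero, Real.exp_zero, mul_one]
    have : 0 ≤ a / ρ := div_nonneg ha hρ.le
    linarith
  intro τ hτ
  have h := trailPair_nonpos_of_deriv_le hT hr hdc h0 hdd τ hτ
  linarith

/-- **Bond damping.** If `x, r` are continuous on `[0, T]`, `r ≤ -ρ < 0` inside,
`|x' - r x| ≤ a + B e^{-θ t}` inside (`a, B ≥ 0`, `ρ ≤ θ`) and `|x(0)| ≤ c₀`, then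
`|x(τ)| ≤ a / ρ + (c₀ + B τ) e^{-ρ τ}` on `[0, T]` (the one-sided bound for `x` and for `-x`).
[folklore] -/
theorem trailPair_bond {x r : ℝ → ℝ} {a B c₀ ρ θ T : ℝ} (hT : 0 ≤ T) (ha : 0 ≤ a) (hB : 0 ≤ B)
    (hρ : 0 < ρ) (hρθ : ρ ≤ θ) (hx : ContinuousOn x (Icc 0 T)) (hr : ContinuousOn r (Icc 0 T))
    (hrρ : ∀ t ∈ Ioo 0 T, r t ≤ -ρ) (hx0 : |x 0| ≤ c₀)
    (hd : ∀ t ∈ Ioo 0 T, ∃ x' : ℝ, HasDerivAt x x' t ∧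
      |x' - r t * x t| ≤ a + B * Real.exp (-(θ * t))) :
    ∀ τ ∈ Icc 0 T, |x τ| ≤ a / ρ + (c₀ + B * τ) * Real.exp (-(ρ * τ)) := by
  have hc₀ : 0 ≤ c₀ := (abs_nonneg _).trans hx0
  intro τ hτ
  have hup := trailPair_bond_upper hT ha hB hc₀ hρ hρθ hx hr hrρ (le_abs_self _ |>.trans hx0)
    (fun t ht => by
      obtain ⟨x', hx', hb⟩ := hd t ht
      exact ⟨x', hx', (abs_le.1 hb).2⟩) τ hτ
  have hlo := trailPair_bond_upper (x := fun t => -x t) hT ha hB hc₀ hρ hρθ hx.neg hr hrρ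
    (neg_le_abs _ |>.trans hx0) (fun t ht => by
      obtain ⟨x', hx', hb⟩ := hd t ht
      exact ⟨-x', hx'.neg, by linarith [(abs_le.1 hb).1]⟩) τ hτ
  rw [abs_le]
  constructor <;> linarith


/-- **Registered tools stub `stub_trailPairTools`** (line `Sketch` of crux
`PerpetualPump.AveragedTypeIBlowup`, stmt-NavierStokesRegularity-1835): the carrier relaxation
bound `|x' + x| ≤ A + B e^{-θt} ⇒ |x(τ) - x(0)e^{-τ}| ≤ A + Bτe^{-θτ}`, the bond damping bound
`|x' - r x| ≤ a + B e^{-θt}, r ≤ -ρ ⇒ |x(τ)| ≤ a/ρ + (c₀ + Bτ)e^{-ρτ}`, and continuous induction on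
`[0, T]`. [folklore] -/
theorem stub_trailPairTools :
    (∀ (x : ℝ → ℝ) (A B θ T : ℝ), 0 ≤ T → 0 ≤ A → 0 ≤ B → θ ≤ 1 → ContinuousOn x (Icc 0 T) →
      (∀ t ∈ Ioo 0 T, ∃ x' : ℝ, HasDerivAt x x' t ∧ |x' + x t| ≤ A + B * Real.exp (-(θ * t))) →
      ∀ τ ∈ Icc 0 T, |x τ - x 0 * Real.exp (-τ)| ≤ A + B * τ * Real.exp (-(θ * τ))) ∧
    (∀ (x r : ℝ → ℝ) (a B c₀ ρ θ T : ℝ), 0 ≤ T → 0 ≤ a → 0 ≤ B → 0 < ρ → ρ ≤ θ →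
      ContinuousOn x (Icc 0 T) → ContinuousOn r (Icc 0 T) → (∀ t ∈ Ioo 0 T, r t ≤ -ρ) →
      |x 0| ≤ c₀ →
      (∀ t ∈ Ioo 0 T, ∃ x' : ℝ, HasDerivAt x x' t ∧
        |x' - r t * x t| ≤ a + B * Real.exp (-(θ * t))) →
      ∀ τ ∈ Icc 0 T, |x τ| ≤ a / ρ + (c₀ + B * τ) * Real.exp (-(ρ * τ))) ∧
    (∀ (f : ℝ → ℝ) (T : ℝ), ContinuousOn f (Icc 0 T) → f 0 ≤ 0 →
      (∀ τ ∈ Icc 0 T, (∀ u ∈ Icc 0 τ, f u ≤ 0) → f τ < 0) → ∀ τ ∈ Icc 0 T, f τ ≤ 0) :=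
  ⟨fun _ _ _ _ _ hT hA hB hθ1 hx hd => trailPair_carrier hT hA hB hθ1 hx hd,
    fun _ _ _ _ _ _ _ _ hT ha hB hρ hρθ hx hr hrρ hx0 hd =>
      trailPair_bond hT ha hB hρ hρθ hx hr hrρ hx0 hd,
    fun _ _ hf h0 hstep => trailPair_realInduction hf h0 hstep⟩

end Summit.NavierStokesRegularity.NavierStokesRegularity.Theorems.PerpetualPumpAveragedTypeIBlowup

end
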